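import Literature.AlgebraicGeometry.ShimuraVarieties.UnitaryConeDiscontinuity
import Literature.AlgebraicGeometry.HodgeTheory.ComplexConjugationHolds
import Literature.NumberTheory.ModularForms.SiegelSymplecticVolume
import Literature.NumberTheory.Transcendental.AnalytificationCoordinateHolomorphyTransport
import Literature.NumberTheory.Transcendental.AnalytificationMorphismsProofs
import Literature.NumberTheory.Transcendental.AnalytificationProjProofs
import Literature.AlgebraicGeometry.Motives.ClosedGraphMorphismImmersion
import Literature.AlgebraicGeometry.Resolution.SmoothStalksRegular
import HarnessLib

/-!
# Borel's extension theorem for a compact ball quotient of ANY rank into an abstractly uniformised smooth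
# quasi-projective target — ONE PIECE, from GAGA

Topic `AlgebraicGeometry/ShimuraVarieties`; namespace `Literature.AlgebraicGeometry.ShimuraVarieties`
(grouping sub-namespace `UnitaryBallUniformisationDatum`).  THEOREMS ONLY (no definition, no named fact, no
instance, no `sorry`).  The rank-free, frame-free and target-abstract companion of ★
`SiegelBorelExtensionPiece.exists_hom_of_holomorphicSiegelLift` (whose source is a rank-`2` ball quotient read in a
Sylvester frame and whose target is a `SiegelComplexRecordSystem`): here the SOURCE is a compact ball quotient
`D : UnitaryBallUniformisationDatum p X` of any rank `p` (for `p = 1`: a compact DISC quotient, e.g. a piece of a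
unitary Shimura curve `Sh_K(U(J⋆), 𝔻)_ℂ`, ★ `UnitaryShimuraCurveRecord.RecordSystemGS.pieces`), read directly in cone
coordinates, and the TARGET is any smooth quasi-projective `ℂ`-scheme `V` together with a CHART
`(Sc, ιc : Sc ⟶ V, unif : 𝔥_g → Sc(ℂ))` — a piece of `V` uniformised by the Siegel upper half space, `unif`
continuous on `𝔥_g` and holomorphic in every affine algebraic coordinate of `Sc` (the (U1)/(U2+) clauses of ★
`SiegelModuliDatum` / ★ `siegelModuli_complexUniformisation_holds`, taken BY VALUE so that the pieces of
`𝓐_{g,δ,N} ⊗_ℚ ℂ` dock by name).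

## The mathematics

Let `f : X(ℂ) → V(ℂ)` be a point map WITH A HOLOMORPHIC SIEGEL LIFT on the cone:
`f (unif_D v) = ιc (unif (Z v))` for `v` in the negative cone of `H^{τ₁}`, with `Z` entrywise holomorphic on the
cone and `𝔥_g`-valued there.  Then `f` is the map on complex points of a morphism of `ℂ`-schemes `ψ : X ⟶ V`
(`exists_hom_of_holomorphicSiegelLift_chart`; with the Hodge model of `X` supplied by ★
`HodgeTheory.exists_isReal_hodgeModel_holds`: `exists_hom_of_holomorphicSiegelLift_chart'`).

Proof.  `V` is smooth quasi-projective: an immersion `e : V ⟶ P̄ ⟶ ℙᵇ`.  Let `A` be a Hodge model of the smooth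
projective `X` (its analytification `ψ_A : X^an ≃ X(ℂ)`).  The map `F := (ℙᵇ)^an⁻¹ ∘ e(ℂ) ∘ f ∘ ψ_A : X^an → ℙᵇ(ℂ)^an`
is holomorphic: near `x ∈ X^an` pick a negative vector `v₀` over `x` and a HOLOMORPHIC LOCAL SECTION `σ` of
`ψ_A⁻¹ ∘ unif_D` through `v₀` (★ `UnitaryConeDiscontinuity.exists_mdifferentiableAt_section'`: a torsion-free
congruence subgroup of `U(p,1)` acts freely and properly discontinuously, so `unif_D` is locally injective modulo
`ℂˣ`); then `F = ((ℙᵇ)^an⁻¹ ∘ (ιc ≫ e)(ℂ) ∘ unif ∘ Z) ∘ σ` near `x`, and `(ℙᵇ)^an⁻¹ ∘ (ιc ≫ e)(ℂ) ∘ unif` is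
holomorphic on `𝔥_g` (read in Klingen's coordinates `ℂ^{g(g+1)/2}`) because `unif` is continuous and holomorphic in
algebraic coordinates (★ `differentiableOn_evalOrZero_map_comp`, ★ `IsAnalytification.mdifferentiableAt_symm_comp`).
By GAGA for maps between smooth projective varieties (★ `Transcendental.arapura2012_cor_15_4_6_holds`) `F` is the
analytification of a morphism `g₀ : X ⟶ ℙᵇ`; all its `ℂ`-points lie in the locally closed `e(V)`, so `g₀` factors
through `e` (★ `Motives.range_subset_of_isLocallyClosed_of_forall_pt_mem`,
★ `Motives.exists_hom_comp_eq_of_range_subset_of_isImmersion`).  This is Borel's theorem [Borel 1972, Thm. 3.10]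
in the compact-source case (no punctured-disc extension needed), in the form used for the slice morphisms
`Sh(U(J⋆), 𝔻)_ℂ → 𝓐_{g,δ,N} ⊗ ℂ` of PEL type ([Deligne1971TravauxShimura] 4.11–4.12; [Milne2005ShimuraVarieties] Thm. 5.16).

## References
* [Borel1972ExtensionTheorem] A. Borel, J. Differential Geom. 6 (1972), Thm. 3.10 p. 559.
* [Mumford1981] D. Mumford, *Algebraic Geometry I: Complex Projective Varieties*, §4B (4.14), p. 67.
* [SerreGAGA1956] J.-P. Serre, GAGA, Ann. Inst. Fourier 6 (1956), §2 n°5–6, §19 Prop. 13.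
* [Arapura2012] D. Arapura, *Algebraic Geometry over the Complex Numbers* (2012), §15.4 Cor. 15.4.6.
* [Milne2005ShimuraVarieties] J. S. Milne, *Introduction to Shimura varieties*, Thm. 3.14 (Borel), Thm. 5.16.
* [BergeronMillsonMoeglin2016Balls] N. Bergeron, J. Millson, C. Moeglin, Acta Math. 216 (2016), Introduction §1.1.
-/

set_option autoImplicit false

noncomputable section

open Function Topology CategoryTheory CategoryTheory.Limits Matrix AlgebraicGeometry Set Filter
open scoped Matrix Manifold ContDiff LinearAlgebra.Projectivization Matrix.Norms.Elementwise
open Literature.AlgebraicGeometry.Motives Literature.AlgebraicGeometry.Motives.AlgPoints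
open Literature.AlgebraicGeometry.HodgeTheory (IsQuasiProjectiveOver HodgeModel)
open Literature.NumberTheory.Transcendental
open Literature.NumberTheory.Automorphic (siegelUpperHalfSpace)
open Literature.NumberTheory.ModularForms.SiegelUpperHalfSpace (siegelUpperHalfSpaceCoord coordCLE
  isOpen_siegelUpperHalfSpaceCoord mem_siegelUpperHalfSpaceCoord_iff)
open Literature.LinearAlgebra.Matrix (symmetricSubmodule)

namespace Literature.AlgebraicGeometry.ShimuraVarieties

namespace UnitaryBallUniformisationDatum

variable {p : ℕ} {X : SchemeOver ℂ} (D : UnitaryBallUniformisationDatum p X)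
variable {g : ℕ}

omit D in
/-- On a symmetric value, SYMMETRISED Klingen coordinates `S w {i,j} = (A(w)_{ij} + A(w)_{ji})/2` are the Klingen
coordinates: the symmetric matrix with coordinates `S w` is `A w` (private plumbing; the symmetrisation lets the
coordinate map be written without a symmetry hypothesis). [cite: Klingen1990, Ch. I §1 Def. 2 (p. 2)] -/
private theorem coe_coordCLE_symm_of_symmetrised' (A : (Fin (p + 1) → ℂ) → Matrix (Fin g) (Fin g) ℂ)
    (S : (Fin (p + 1) → ℂ) → Sym2 (Fin g) → ℂ) (hS : ∀ w i j, S w s(i, j) = (A w i j + A w j i) / 2)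
    (w : Fin (p + 1) → ℂ) (hA : (A w).IsSymm) :
    (((coordCLE g).symm (S w) : symmetricSubmodule (Fin g) ℂ) : Matrix (Fin g) (Fin g) ℂ) = A w := by
  ext i j
  rw [Literature.NumberTheory.ModularForms.SiegelUpperHalfSpace.coe_coordCLE_symm_apply, hS, hA.apply i j]
  ring

omit D in
/-- Symmetrised coordinates of a map with differentiable entries are differentiable (private plumbing).
[cite: Klingen1990, Ch. I §1 Def. 2 (p. 2)] -/
private theorem differentiableAt_of_symmetrised' (A : (Fin (p + 1) → ℂ) → Matrix (Fin g) (Fin g) ℂ)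
    (S : (Fin (p + 1) → ℂ) → Sym2 (Fin g) → ℂ) (hS : ∀ w i j, S w s(i, j) = (A w i j + A w j i) / 2)
    {w : Fin (p + 1) → ℂ} (hA : ∀ i j, DifferentiableAt ℂ (fun w => A w i j) w) : DifferentiableAt ℂ S w := by
  refine differentiableAt_pi.2 fun s => ?_
  induction s using Sym2.ind with
  | h i j =>
    have h : (fun w => S w s(i, j)) = fun w => (A w i j + A w j i) * (2 : ℂ)⁻¹ :=
      funext fun w => by rw [hS, div_eq_mul_inv]
    rw [h]
    have h1 : DifferentiableAt ℂ (fun w => A w i j + A w j i) w := (hA i j).add (hA j i)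
    exact h1.mul_const _

omit D in
/-- **A chart holomorphic in algebraic coordinates is holomorphic in Klingen's coordinates** (the matrix-form
(U2+) clause of ★ `SiegelModuliDatum`, precomposed with the linear coordinate map `ℂ^{g(g+1)/2} → Sym_g(ℂ)`; the
chart-free twin of ★ `SiegelModuliDatum.differentiableOn_unif_coord`). [cite: CharlesSchnell2014Notes, Thm. 11.5.10 (p. 516)]
[cite: Klingen1990, Ch. I §1 Def. 2 (p. 2)] -/
theorem differentiableOn_chart_coord {Sc : SchemeOver ℂ} (unif : Matrix (Fin g) (Fin g) ℂ → ComplexPoints Sc)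
    (hhol : ∀ (U : Sc.left.affineOpens) (s : Sc.left.presheaf.obj (Opposite.op (↑U : Sc.left.Opens))),
      DifferentiableOn ℂ (fun Z ↦ evalOrZero (↑U : Sc.left.Opens) s (unif Z))
        (siegelUpperHalfSpace g ∩ unif ⁻¹' {P | P.pt ∈ (↑U : Sc.left.Opens)}))
    (U : Sc.left.affineOpens) (s : Sc.left.presheaf.obj (Opposite.op (↑U : Sc.left.Opens))) :
    DifferentiableOn ℂ
      (fun v : Sym2 (Fin g) → ℂ ↦ evalOrZero (↑U : Sc.left.Opens) s
        (unif (((coordCLE g).symm v : symmetricSubmodule (Fin g) ℂ) : Matrix (Fin g) (Fin g) ℂ)))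
      (siegelUpperHalfSpaceCoord g ∩
        (fun v ↦ unif (((coordCLE g).symm v : symmetricSubmodule (Fin g) ℂ) :
          Matrix (Fin g) (Fin g) ℂ)) ⁻¹' {P | P.pt ∈ (↑U : Sc.left.Opens)}) := by
  set L : (Sym2 (Fin g) → ℂ) →L[ℂ] Matrix (Fin g) (Fin g) ℂ :=
    (symmetricSubmodule (Fin g) ℂ).subtypeL.comp ((coordCLE g).symm : _ →L[ℂ] _) with hL
  have hLv : ∀ v, L v = (((coordCLE g).symm v : symmetricSubmodule (Fin g) ℂ) :
      Matrix (Fin g) (Fin g) ℂ) := fun v ↦ rfl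
  have hmaps : MapsTo L
      (siegelUpperHalfSpaceCoord g ∩
        (fun v ↦ unif (((coordCLE g).symm v : symmetricSubmodule (Fin g) ℂ) :
          Matrix (Fin g) (Fin g) ℂ)) ⁻¹' {P | P.pt ∈ (↑U : Sc.left.Opens)})
      (siegelUpperHalfSpace g ∩ unif ⁻¹' {P | P.pt ∈ (↑U : Sc.left.Opens)}) := by
    intro v hv
    refine ⟨?_, ?_⟩
    · rw [hLv]; exact (mem_siegelUpperHalfSpaceCoord_iff).1 hv.1
    · show (unif (L v)).pt ∈ (↑U : Sc.left.Opens)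
      rw [hLv]; exact hv.2
  have hcomp := (hhol U s).comp L.differentiableOn hmaps
  refine hcomp.congr fun v _ ↦ ?_
  simp only [Function.comp_apply, hLv]

omit D in
/-- A chart continuous on `𝔥_g` is continuous in Klingen's coordinates. [cite: Klingen1990, Ch. I §1 Def. 2 (p. 2)] -/
theorem continuousOn_chart_coord {Sc : SchemeOver ℂ} (unif : Matrix (Fin g) (Fin g) ℂ → ComplexPoints Sc)
    (hcont : ContinuousOn unif (siegelUpperHalfSpace g)) :
    ContinuousOn (fun v : Sym2 (Fin g) → ℂ ↦
        unif (((coordCLE g).symm v : symmetricSubmodule (Fin g) ℂ) : Matrix (Fin g) (Fin g) ℂ))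
      (siegelUpperHalfSpaceCoord g) := by
  have hc : Continuous fun v : Sym2 (Fin g) → ℂ =>
      (((coordCLE g).symm v : symmetricSubmodule (Fin g) ℂ) : Matrix (Fin g) (Fin g) ℂ) :=
    continuous_subtype_val.comp (coordCLE g).symm.continuous
  exact hcont.comp hc.continuousOn fun v hv => (mem_siegelUpperHalfSpaceCoord_iff).1 hv

/-- **Borel's extension theorem on ONE compact ball-quotient piece of any rank, into an abstractly uniformised smooth
quasi-projective target, from GAGA** (Hodge model of the source as input).  `D` a compact ball-quotient datum of rank
`p` on `X`, `A` a Hodge model of `X`; `V` a smooth quasi-projective `ℂ`-scheme with a chart `ιc : Sc ⟶ V`,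
`unif : 𝔥_g → Sc(ℂ)` continuous on `𝔥_g` and holomorphic in every affine algebraic coordinate; `f : X(ℂ) → V(ℂ)` a
point map which on the negative cone factors as `ιc ∘ unif ∘ Z` with `Z` entrywise holomorphic and `𝔥_g`-valued:
then `f` is induced by a morphism of `ℂ`-schemes `ψ : X ⟶ V`.  (GAGA for maps ★ `arapura2012_cor_15_4_6_holds`
towards `ℙᵇ ⊇ P̄ ⊇ V`; holomorphy read on regular functions; source holomorphy through holomorphic local sections
of the uniformisation, ★ `exists_mdifferentiableAt_section'`; factorisation through the immersion `V ↪ ℙᵇ`.)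
[cite: Borel1972ExtensionTheorem, Thm. 3.10 p. 559] [cite: Mumford1981, §4B (4.14) p. 67]
[cite: Milne2005ShimuraVarieties, Thm. 3.14 and Thm. 5.16] [cite: Arapura2012, §15.4 Cor. 15.4.6] -/
theorem exists_hom_of_holomorphicSiegelLift_chart (A : HodgeModel p X) (V : SchemeOver ℂ) [Smooth V.hom]
    (hV : IsQuasiProjectiveOver V) {Sc : SchemeOver ℂ} (ιc : Sc ⟶ V)
    (unif : Matrix (Fin g) (Fin g) ℂ → ComplexPoints Sc) (hcont : ContinuousOn unif (siegelUpperHalfSpace g))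
    (hhol : ∀ (U : Sc.left.affineOpens) (s : Sc.left.presheaf.obj (Opposite.op (↑U : Sc.left.Opens))),
      DifferentiableOn ℂ (fun Z ↦ evalOrZero (↑U : Sc.left.Opens) s (unif Z))
        (siegelUpperHalfSpace g ∩ unif ⁻¹' {P | P.pt ∈ (↑U : Sc.left.Opens)}))
    (f : ComplexPoints X → ComplexPoints V) (Z : (Fin (p + 1) → ℂ) → Matrix (Fin g) (Fin g) ℂ)
    (hZ : ∀ i j, DifferentiableOn ℂ (fun v => Z v i j) D.cone)
    (hZmem : ∀ v ∈ D.cone, Z v ∈ siegelUpperHalfSpace g)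
    (hf : ∀ v ∈ D.cone, f (D.unif v) = AlgPoints.map ιc (unif (Z v))) :
    ∃ ψ : X ⟶ V, ∀ P : ComplexPoints X, AlgPoints.map ψ P = f P := by
  classical
  -- §0 the schemes: `X` smooth projective (reduced, finite type), `V` smooth quasi-projective, `e : V ↪ ℙᵇ`
  have hX : IsSmoothProjective p X := D.isSmoothProjective
  haveI : SmoothOfRelativeDimension p X.hom := hX.smoothOfRelativeDimension
  haveI : Smooth X.hom := SmoothOfRelativeDimension.smooth p X.hom
  haveI : LocallyOfFiniteType X.hom := inferInstance
  haveI : IsIntegral X.left := IsSmoothProjective.isIntegral_holds hX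
  haveI : IsReduced V.left := Literature.AlgebraicGeometry.Resolution.isReduced_of_smooth V.hom
  haveI : LocallyOfFiniteType V.hom := inferInstance
  obtain ⟨Pbar, j, hPbar, hj⟩ := hV
  obtain ⟨b, ι, hι⟩ := hPbar
  haveI := hj
  haveI := hι
  obtain ⟨e, he⟩ : ∃ e : V ⟶ projectiveSpace b ℂ, e = j ≫ ι := ⟨_, rfl⟩
  haveI he_imm : IsImmersion e.left := by
    rw [he, Over.comp_left]
    infer_instance
  have he_inj : Function.Injective e.left.base := e.left.isEmbedding.injective
  -- §1 the target `ℙᵇ`: smooth projective, analytified by Mathlib's projectivization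
  have hP : IsSmoothProjective b (projectiveSpace b ℂ) := isSmoothProjective_projectiveSpace_holds ℂ b
  haveI : SmoothOfRelativeDimension b (projectiveSpace b ℂ).hom := hP.smoothOfRelativeDimension
  haveI : IsManifold 𝓘(ℂ, Fin b → ℂ) ω (ℙ ℂ (Fin (b + 1) → ℂ)) := isManifold_projectivization_holds ℂ b
  have hψ : IsAnalytification (Fin b → ℂ) (projectiveSpace b ℂ) b (projPoint b) := isAnalytification_projPoint b
  -- §2 the map between the analytifications `X^an → (ℙᵇ)^an` and the chart read in Klingen's coordinates
  obtain ⟨F, hFdef⟩ : ∃ F : A.carrier → ℙ ℂ (Fin (b + 1) → ℂ),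
      F = fun x => hψ.homeomorph.symm (AlgPoints.map e (f (A.toComplexPoints x))) := ⟨_, rfl⟩
  obtain ⟨uS, huS⟩ : ∃ uS : (Sym2 (Fin g) → ℂ) → ComplexPoints (projectiveSpace b ℂ),
      uS = AlgPoints.map (ιc ≫ e) ∘ fun v : Sym2 (Fin g) → ℂ =>
        unif (((coordCLE g).symm v : symmetricSubmodule (Fin g) ℂ) : Matrix (Fin g) (Fin g) ℂ) :=
    ⟨_, rfl⟩
  -- symmetrised Klingen coordinates of `Z`
  obtain ⟨SC, hSC⟩ : ∃ S : (Fin (p + 1) → ℂ) → Sym2 (Fin g) → ℂ, ∀ w i j, S w s(i, j) = (Z w i j + Z w j i) / 2 :=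
    ⟨fun w s => Sym2.lift ⟨fun i j => (Z w i j + Z w j i) / 2, fun i j => by ring⟩ s,
      fun w i j => by simp only [Sym2.lift_mk]⟩
  -- the lift identity on the cone: `(ℙᵇ)^an⁻¹ (e (f (unif_D v))) = ((ℙᵇ)^an⁻¹ ∘ uS) (SC v)`
  have hkey : ∀ v ∈ D.cone, hψ.homeomorph.symm (AlgPoints.map e (f (D.unif v))) =
      (hψ.homeomorph.symm ∘ uS) (SC v) := by
    intro v hv
    have hsym : (Z v).IsSymm := (hZmem v hv).1
    rw [huS]
    change hψ.homeomorph.symm (AlgPoints.map e (f (D.unif v))) =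
      hψ.homeomorph.symm (AlgPoints.map (ιc ≫ e) (unif
        (((coordCLE g).symm (SC v) : symmetricSubmodule (Fin g) ℂ) : Matrix (Fin g) (Fin g) ℂ)))
    rw [coe_coordCLE_symm_of_symmetrised' Z SC hSC v hsym, AlgPoints.map_comp_apply, hf v hv]
  -- §3 holomorphy of the Siegel side `(ℙᵇ)^an⁻¹ ∘ uS` on `𝔥_g` (Klingen coordinates)
  have hcontU := continuousOn_chart_coord unif hcont
  have hcontS : ContinuousOn uS (siegelUpperHalfSpaceCoord g) := by
    rw [huS]
    exact (AlgPoints.continuous_map _).comp_continuousOn hcontU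
  have hholS := differentiableOn_evalOrZero_map_comp isOpen_siegelUpperHalfSpaceCoord hcontU
    (differentiableOn_chart_coord unif hhol) (ιc ≫ e)
  rw [← huS] at hholS
  have hcone : IsOpen D.cone := isOpen_negCone _
  -- the composite `v ↦ ((ℙᵇ)^an⁻¹ ∘ uS) (SC v)` is holomorphic at every cone vector
  have hconeHol : ∀ v ∈ D.cone, MDifferentiableAt 𝓘(ℂ, Fin (p + 1) → ℂ) 𝓘(ℂ, Fin b → ℂ)
      ((hψ.homeomorph.symm ∘ uS) ∘ SC) v := by
    intro v hv
    have hsym : (Z v).IsSymm := (hZmem v hv).1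
    have hmem : SC v ∈ siegelUpperHalfSpaceCoord g := by
      rw [mem_siegelUpperHalfSpaceCoord_iff, coe_coordCLE_symm_of_symmetrised' Z SC hSC v hsym]
      exact hZmem v hv
    have hS : MDifferentiableAt 𝓘(ℂ, Sym2 (Fin g) → ℂ) 𝓘(ℂ, Fin b → ℂ) (hψ.homeomorph.symm ∘ uS) (SC v) :=
      hψ.mdifferentiableAt_symm_comp isOpen_siegelUpperHalfSpaceCoord hcontS hholS hmem
    have hZd : ∀ i j, DifferentiableAt ℂ (fun w => Z w i j) v := fun i j =>
      (hZ i j).differentiableAt (hcone.mem_nhds hv)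
    have hsc : MDifferentiableAt 𝓘(ℂ, Fin (p + 1) → ℂ) 𝓘(ℂ, Sym2 (Fin g) → ℂ) SC v :=
      mdifferentiableAt_iff_differentiableAt.2 (differentiableAt_of_symmetrised' Z SC hSC hZd)
    exact hS.comp v hsc
  -- §4 holomorphy of `F` through holomorphic local sections of `unif_D` (★ `exists_mdifferentiableAt_section'`)
  have hF : MDifferentiable 𝓘(ℂ, A.model) 𝓘(ℂ, Fin b → ℂ) F := by
    intro x
    obtain ⟨v₀, hv₀, hP⟩ := D.surjOn_unif (mem_univ (A.toComplexPoints x))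
    obtain ⟨W, σ, hWo, hx₀W, -, hσ, hσd⟩ := D.exists_mdifferentiableAt_section' A hv₀
    have hx₀ : A.isAnalytification.homeomorph.symm (D.unif v₀) = x := by
      rw [hP]; exact A.isAnalytification.homeomorph.symm_apply_apply x
    rw [hx₀] at hx₀W
    -- `F = ((ℙᵇ)^an⁻¹ ∘ uS ∘ SC) ∘ σ` near `x`
    have key : F =ᶠ[𝓝 x] fun x' => ((hψ.homeomorph.symm ∘ uS) ∘ SC) (σ x') := by
      filter_upwards [hWo.mem_nhds hx₀W] with x' hx'
      rw [hFdef]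
      change hψ.homeomorph.symm (AlgPoints.map e (f (A.toComplexPoints x'))) = _
      rw [← (hσ x' hx').2]
      exact hkey _ (hσ x' hx').1
    refine MDifferentiableAt.congr_of_eventuallyEq ?_ key
    exact (hconeHol _ (hσ x hx₀W).1).comp x (hσd x hx₀W)
  -- §5 GAGA for maps: `F` is the analytification of a morphism `g₀ : X ⟶ ℙᵇ`
  obtain ⟨g₀, hg₀⟩ := arapura2012_cor_15_4_6_holds X (projectiveSpace b ℂ) hX hP A.model A.carrier
    A.toComplexPoints A.isAnalytification (Fin b → ℂ) (ℙ ℂ (Fin (b + 1) → ℂ)) (projPoint b) hψ F hF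
  -- points of `g₀`: `g₀(P) = e(f P)`
  have hg₀pt : ∀ P : ComplexPoints X, AlgPoints.map g₀ P = AlgPoints.map e (f P) := by
    intro P
    obtain ⟨m, rfl⟩ := A.isAnalytification.homeomorph.surjective P
    rw [A.isAnalytification.coe_homeomorph, ← hg₀ m, hFdef]
    simpa only [hψ.coe_homeomorph] using hψ.homeomorph.apply_symm_apply (AlgPoints.map e (f _))
  -- §6 `g₀` lands in the locally closed `e(V)`, hence factors through `e`
  have hpts : ∀ P : AlgPoints X ℂ, g₀.left.base P.pt ∈ Set.range e.left.base := by
    intro P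
    refine ⟨(f P).pt, ?_⟩
    change (AlgPoints.map e (f P)).pt = (AlgPoints.map g₀ P).pt
    rw [hg₀pt P]
  have hrange : Set.range g₀.left.base ⊆ Set.range e.left.base :=
    range_subset_of_isLocallyClosed_of_forall_pt_mem (T := X) g₀.left e.left.isLocallyClosed_range hpts
  obtain ⟨ψ, hψe⟩ := exists_hom_comp_eq_of_range_subset_of_isImmersion (T := X) e g₀ hrange
  refine ⟨ψ, fun P => ?_⟩
  -- points agree because `e` is injective on complex points
  apply AlgPoints.eq_of_pt_eq
  apply he_inj
  have h1 : AlgPoints.map e (AlgPoints.map ψ P) = AlgPoints.map e (f P) := by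
    rw [← AlgPoints.map_comp_apply, hψe, hg₀pt P]
  have h2 := congrArg AlgPoints.pt h1
  simpa only [AlgPoints.pt_map] using h2

/-- **Borel's extension theorem on ONE compact ball-quotient piece of any rank, into an abstractly uniformised smooth
quasi-projective target** — the Hodge model of the source supplied by ★ `HodgeTheory.exists_isReal_hodgeModel_holds`
(`X` is smooth projective, field `isSmoothProjective`).  For `p = 1` and `V = 𝓐_{g,δ,N} ⊗_ℚ ℂ` with its pieces: the
slice morphism `Sh_K(U(J⋆), 𝔻)_ℂ|_{piece} ⟶ 𝓐_{g,δ,N} ⊗ ℂ` of a holomorphic period map.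
[cite: Borel1972ExtensionTheorem, Thm. 3.10 p. 559] [cite: Milne2005ShimuraVarieties, Thm. 3.14 and Thm. 5.16]
[cite: Deligne1971TravauxShimura, 4.11–4.12 p. 148] [cite: Arapura2012, §15.4 Cor. 15.4.6] -/
theorem exists_hom_of_holomorphicSiegelLift_chart' (V : SchemeOver ℂ) [Smooth V.hom]
    (hV : IsQuasiProjectiveOver V) {Sc : SchemeOver ℂ} (ιc : Sc ⟶ V)
    (unif : Matrix (Fin g) (Fin g) ℂ → ComplexPoints Sc) (hcont : ContinuousOn unif (siegelUpperHalfSpace g))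
    (hhol : ∀ (U : Sc.left.affineOpens) (s : Sc.left.presheaf.obj (Opposite.op (↑U : Sc.left.Opens))),
      DifferentiableOn ℂ (fun Z ↦ evalOrZero (↑U : Sc.left.Opens) s (unif Z))
        (siegelUpperHalfSpace g ∩ unif ⁻¹' {P | P.pt ∈ (↑U : Sc.left.Opens)}))
    (f : ComplexPoints X → ComplexPoints V) (Z : (Fin (p + 1) → ℂ) → Matrix (Fin g) (Fin g) ℂ)
    (hZ : ∀ i j, DifferentiableOn ℂ (fun v => Z v i j) D.cone)
    (hZmem : ∀ v ∈ D.cone, Z v ∈ siegelUpperHalfSpace g)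
    (hf : ∀ v ∈ D.cone, f (D.unif v) = AlgPoints.map ιc (unif (Z v))) :
    ∃ ψ : X ⟶ V, ∀ P : ComplexPoints X, AlgPoints.map ψ P = f P :=
  let ⟨A, _⟩ := Literature.AlgebraicGeometry.HodgeTheory.exists_isReal_hodgeModel_holds p X D.isSmoothProjective
  D.exists_hom_of_holomorphicSiegelLift_chart A V hV ιc unif hcont hhol f Z hZ hZmem hf

end UnitaryBallUniformisationDatum

end Literature.AlgebraicGeometry.ShimuraVarieties

end
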